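import Literature.MathematicalPhysics.QuantumFieldTheory.Balaban1983to89.BlockAveragingExpMeanLog
import Summits.QuantumFields.BalabanUV.Beta.EriceAxialGaugeWords
import HarnessLib

/-!
# Route `UnitScaleTilt`, crux K1 child «MinimiserStabilityRegPr» (stmt-QuantumFields-19200), stub `stub_avgActionDefect` — helper 1:
# the printed operation `exp[mean log]` of [Balaban1987RG1] (0.4) TO FIRST ORDER:
# `‖eml W − 1 − mean_i (W_i − 1)‖ ≤ 7·t²` for `‖W_i − 1‖ ≤ t ≤ 1/10`, and the second-order Taylor bound for a product of four
# corrected transporters (the shape of a coarse plaquette of the (0.4) block averaging)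

Cell `ym3-torus` (HUMAN RULING D-0037, YM ladder rung R3), seat `ym3-torus-p1` gen 8; crux K1 of the route `UnitScaleTilt`, child
«MinimiserStabilityRegPr» (stmt-QuantumFields-19200), registered stub `stub_avgActionDefect` (located gap G-K1a-3b′, schema
`T3LowerActionSplit.AvgActionDefectAt`).  The zeroth-order sibling is `BlockAveragingPlaquetteBound` (`‖eml W − 1‖ ≤ 6t`).

* (inputs, tree) `EriceAxialGaugeWords.norm_mlog_sub_sub_one_le` (`‖log X − (X − 1)‖ ≤ 2‖X − 1‖²` on `‖X − 1‖ ≤ ½`),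
  `OneLinkLaplace.norm_exp_sub_one_sub_le_sq` (`‖e^Z − 1 − Z‖ ≤ ‖Z‖²` on `‖Z‖ ≤ 1`).
* §1 **`norm_eml_sub_one_sub_mean_le`**: `‖eml W − 1 − |I|⁻¹ Σ_i (W_i − 1)‖ ≤ 7t²` for `‖W_i − 1‖ ≤ t ≤ 1/10`; `eml_comp_equiv'`
  (reindexing along a bijection of index TYPES), `norm_mean_le`, `mean_comp_equiv'`.
* §2 the product `(1+X₁)g₁(1+X₂)g₂(1+X₃)g₃(1+X₄)` of four corrected transporters to second order: **`norm_prod4_sub_mean_le`** —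
  if `‖g_i‖ ≤ 1`, `‖X_i‖ ≤ s ≤ 1`, `‖Y_i(k)‖ ≤ t ≤ 1` and each `X_i` is within `ρ` of the mean of the `Y_i(k)`, then the product at `X`
  is within `4ρ + 11s² + 11t²` of the mean over `k` of the products at `Y(k)` .

Everything here is elementary Banach-algebra analysis (our own statements, tagged [folklore]); it is filed on the Summits side as
route-helper mathematics for the located (unprinted) stub G-K1a-3b′.

References: T. Bałaban, CMP 98 (1985) 17–51 [Balaban1985Averaging] ((26)–(27) p.22); CMP 109 (1987) 249–301 [Balaban1987RG1] ((0.4) p.253).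
-/

noncomputable section

open NormedSpace
open scoped BigOperators

namespace Summit.QuantumFields.YangMills.Theorems.AvgActionDefect

open Literature.MathematicalPhysics.QuantumFieldTheory.Balaban1983to89
open Literature.MathematicalPhysics.QuantumFieldTheory.OneLinkLaplace (norm_exp_sub_one_sub_le_sq)
open Summit.QuantumFields.BalabanUV.Beta.EriceAxialGaugeWords (norm_mlog_sub_sub_one_le)
open ExpMeanLog MatrixLog B7BlockAvgLog

/-! ## §1 `exp[mean log]` to first order -/

section Eml

variable {𝔸 : Type*} [NormedRing 𝔸] [NormedAlgebra ℂ 𝔸] [CompleteSpace 𝔸]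
variable {ι : Type*} [Fintype ι]

omit [CompleteSpace 𝔸] in
/-- `‖|I|⁻¹ Σ_i a_i‖ ≤ t` if every `‖a_i‖ ≤ t` (a convex combination). [folklore] -/
theorem norm_mean_le {a : ι → 𝔸} {t : ℝ} (h : ∀ i, ‖a i‖ ≤ t) (ht : 0 ≤ t) :
    ‖((Fintype.card ι : ℂ))⁻¹ • ∑ i, a i‖ ≤ t := by
  rcases isEmpty_or_nonempty ι with hι | hι
  · simp [ht]
  have hc : (0 : ℝ) < Fintype.card ι := Nat.cast_pos.mpr Fintype.card_pos
  rw [norm_smul, norm_inv, Complex.norm_natCast]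
  calc (Fintype.card ι : ℝ)⁻¹ * ‖∑ i, a i‖ ≤ (Fintype.card ι : ℝ)⁻¹ * ∑ i, ‖a i‖ :=
        mul_le_mul_of_nonneg_left (norm_sum_le _ _) (inv_nonneg.mpr hc.le)
    _ ≤ (Fintype.card ι : ℝ)⁻¹ * ∑ _i : ι, t :=
        mul_le_mul_of_nonneg_left (Finset.sum_le_sum fun i _ => h i) (inv_nonneg.mpr hc.le)
    _ = t := by rw [Finset.sum_const, Finset.card_univ, nsmul_eq_mul, ← mul_assoc, inv_mul_cancel₀ hc.ne', one_mul]

/-- **`exp[mean log]` TO FIRST ORDER**: if every `‖W_i − 1‖ ≤ t ≤ 1/10` then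
`‖eml W − 1 − |I|⁻¹ Σ_i (W_i − 1)‖ ≤ 7t²` — (26)-type `‖log W_i − (W_i − 1)‖ ≤ 2t²`, averaged, plus (27)-type
`‖e^Z − 1 − Z‖ ≤ ‖Z‖² ≤ 4t²` for `Z = |I|⁻¹ Σ_i log W_i`, `‖Z‖ ≤ 2t`. [cite: Balaban1985Averaging, (26)-(27) p.22] -/
theorem norm_eml_sub_one_sub_mean_le {W : ι → 𝔸} {t : ℝ} (hW : ∀ i, ‖W i - 1‖ ≤ t) (ht : t ≤ 1 / 10) :
    ‖eml W - 1 - ((Fintype.card ι : ℂ))⁻¹ • ∑ i, (W i - 1)‖ ≤ 7 * t ^ 2 := by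
  rcases isEmpty_or_nonempty ι with hι | hι
  · have h0 : eml W = 1 := by rw [eml_eq_exp]; simp [exp_zero]
    have hm : ((Fintype.card ι : ℂ))⁻¹ • ∑ i, (W i - 1) = 0 := by simp
    rw [h0, hm, sub_self, sub_zero, norm_zero]
    positivity
  have h0 : 0 ≤ t := (norm_nonneg _).trans (hW (Classical.arbitrary ι))
  set Z : 𝔸 := ((Fintype.card ι : ℂ))⁻¹ • ∑ i, mlog (W i) with hZ_def
  have heml : eml W = exp Z := eml_eq_exp W
  -- `‖Z‖ ≤ 2t`
  have hZ : ‖Z‖ ≤ 2 * t :=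
    norm_mean_le (fun i => (norm_mlog_le_two_mul ((hW i).trans (ht.trans (by norm_num)))).trans (by linarith [hW i]))
      (by linarith)
  -- `‖Z − mean‖ ≤ 2t²`
  have hZm : ‖Z - ((Fintype.card ι : ℂ))⁻¹ • ∑ i, (W i - 1)‖ ≤ 2 * t ^ 2 := by
    have : Z - ((Fintype.card ι : ℂ))⁻¹ • ∑ i, (W i - 1) = ((Fintype.card ι : ℂ))⁻¹ • ∑ i, (mlog (W i) - (W i - 1)) := by
      rw [hZ_def, ← smul_sub, ← Finset.sum_sub_distrib]
    rw [this]
    refine norm_mean_le (fun i => ?_) (by positivity)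
    calc ‖mlog (W i) - (W i - 1)‖ ≤ 2 * ‖W i - 1‖ ^ 2 := norm_mlog_sub_sub_one_le ((hW i).trans (ht.trans (by norm_num)))
      _ ≤ 2 * t ^ 2 := by gcongr; exact hW i
  -- `‖e^Z − 1 − Z‖ ≤ ‖Z‖² ≤ 4t²`
  have hexp : ‖exp Z - 1 - Z‖ ≤ 4 * t ^ 2 := by
    letI : NormedAlgebra ℝ 𝔸 := NormedAlgebra.restrictScalars ℝ ℂ 𝔸
    refine (norm_exp_sub_one_sub_le_sq (hZ.trans (by linarith))).trans ?_
    calc ‖Z‖ ^ 2 ≤ (2 * t) ^ 2 := by gcongr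
      _ = 4 * t ^ 2 := by ring
  calc ‖eml W - 1 - ((Fintype.card ι : ℂ))⁻¹ • ∑ i, (W i - 1)‖
        = ‖(exp Z - 1 - Z) + (Z - ((Fintype.card ι : ℂ))⁻¹ • ∑ i, (W i - 1))‖ := by rw [heml]; congr 1; abel
    _ ≤ ‖exp Z - 1 - Z‖ + ‖Z - ((Fintype.card ι : ℂ))⁻¹ • ∑ i, (W i - 1)‖ := norm_add_le _ _
    _ ≤ 7 * t ^ 2 := by nlinarith [sq_nonneg t]

omit [CompleteSpace 𝔸] in
/-- REINDEXING ALONG A BIJECTION OF INDEX TYPES: `eml (W ∘ e) = eml W` for `e : ι′ ≃ ι` (the tree's `eml_comp_equiv` is the case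
of a permutation of one type). [cite: Balaban1987RG1, (0.7) p.253] -/
theorem eml_comp_equiv' {ι' : Type*} [Fintype ι'] (W : ι → 𝔸) (e : ι' ≃ ι) : eml (W ∘ e) = eml W := by
  rw [eml_eq_exp, eml_eq_exp, Fintype.card_congr e]
  congr 2
  exact e.sum_comp (fun i => mlog (W i))

omit [CompleteSpace 𝔸] in
/-- A mean is invariant under reindexing along a bijection of index types. [folklore] -/
theorem mean_comp_equiv' {ι' : Type*} [Fintype ι'] (a : ι → 𝔸) (e : ι' ≃ ι) :
    ((Fintype.card ι' : ℂ))⁻¹ • ∑ i', a (e i') = ((Fintype.card ι : ℂ))⁻¹ • ∑ i, a i := by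
  rw [Fintype.card_congr e]
  congr 1
  exact e.sum_comp a

end Eml

/-! ## §2 A product of four corrected transporters to second order -/

section Prod4

variable {𝔸 : Type*} [NormedRing 𝔸]

/-- SECOND-ORDER TAYLOR BOUND FOR THE PRODUCT OF FOUR CORRECTED TRANSPORTERS: if `‖g_i‖ ≤ 1` and `‖X_i‖ ≤ s ≤ 1` then
`(1+X₁)g₁(1+X₂)g₂(1+X₃)g₃(1+X₄)` minus `g₁g₂g₃` minus its part linear in the `X_i` has norm `≤ 11s²`
(`(1+s)⁴ − 1 − 4s = 6s² + 4s³ + s⁴ ≤ 11s²`). [folklore] -/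
private theorem norm_prod4_sub_sub_lin4_le {g₁ g₂ g₃ X₁ X₂ X₃ X₄ : 𝔸} {s : ℝ} (h₁ : ‖g₁‖ ≤ 1) (h₂ : ‖g₂‖ ≤ 1)
    (h₃ : ‖g₃‖ ≤ 1) (hX₁ : ‖X₁‖ ≤ s) (hX₂ : ‖X₂‖ ≤ s) (hX₃ : ‖X₃‖ ≤ s) (hX₄ : ‖X₄‖ ≤ s) (hs : s ≤ 1) :
    ‖(1 + X₁) * g₁ * (1 + X₂) * g₂ * (1 + X₃) * g₃ * (1 + X₄) - g₁ * g₂ * g₃ -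
        (X₁ * g₁ * g₂ * g₃ + g₁ * X₂ * g₂ * g₃ + g₁ * g₂ * X₃ * g₃ + g₁ * g₂ * g₃ * X₄)‖ ≤ 11 * s ^ 2 := by
  have s0 : 0 ≤ s := (norm_nonneg _).trans hX₁
  -- nested partial products and their linearisations
  set T₃ : 𝔸 := (1 + X₃) * g₃ * (1 + X₄) with hT₃
  set M₃ : 𝔸 := g₃ + X₃ * g₃ + g₃ * X₄ with hM₃
  set T₂ : 𝔸 := (1 + X₂) * g₂ * T₃ with hT₂
  set M₂ : 𝔸 := g₂ * g₃ + X₂ * g₂ * g₃ + g₂ * X₃ * g₃ + g₂ * g₃ * X₄ with hM₂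
  have hP : (1 + X₁) * g₁ * (1 + X₂) * g₂ * (1 + X₃) * g₃ * (1 + X₄) = (1 + X₁) * g₁ * T₂ := by
    simp only [hT₂, hT₃]; noncomm_ring
  have hL : g₁ * g₂ * g₃ + (X₁ * g₁ * g₂ * g₃ + g₁ * X₂ * g₂ * g₃ + g₁ * g₂ * X₃ * g₃ + g₁ * g₂ * g₃ * X₄) =
      g₁ * M₂ + X₁ * g₁ * (g₂ * g₃) := by
    simp only [hM₂]; noncomm_ring
  -- norms of the building blocks
  have nX₃g : ‖X₃ * g₃‖ ≤ s := (norm_mul_le _ _).trans (by nlinarith [norm_nonneg X₃, norm_nonneg g₃])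
  have ngX₄ : ‖g₃ * X₄‖ ≤ s := (norm_mul_le _ _).trans (by nlinarith [norm_nonneg X₄, norm_nonneg g₃])
  -- level 3: `T₃ − M₃ = X₃ g₃ X₄`, `T₃ − g₃ = X₃g₃ + g₃X₄ + X₃g₃X₄`
  have e3 : T₃ - M₃ = X₃ * g₃ * X₄ := by simp only [hT₃, hM₃]; noncomm_ring
  have n3 : ‖T₃ - M₃‖ ≤ s ^ 2 := by
    rw [e3]; refine (norm_mul_le _ _).trans ?_
    calc ‖X₃ * g₃‖ * ‖X₄‖ ≤ s * s := mul_le_mul nX₃g hX₄ (norm_nonneg _) s0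
      _ = s ^ 2 := by ring
  have e3' : T₃ - g₃ = X₃ * g₃ + g₃ * X₄ + X₃ * g₃ * X₄ := by simp only [hT₃]; noncomm_ring
  have n3' : ‖T₃ - g₃‖ ≤ 2 * s + s ^ 2 := by
    rw [e3']
    calc ‖X₃ * g₃ + g₃ * X₄ + X₃ * g₃ * X₄‖ ≤ ‖X₃ * g₃‖ + ‖g₃ * X₄‖ + ‖X₃ * g₃ * X₄‖ :=
          (norm_add_le _ _).trans (add_le_add (norm_add_le _ _) le_rfl)
      _ ≤ s + s + s ^ 2 := by rw [← e3]; exact add_le_add (add_le_add nX₃g ngX₄) n3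
      _ = 2 * s + s ^ 2 := by ring
  -- level 2: `T₂ − M₂ = g₂(T₃ − M₃) + X₂g₂(T₃ − g₃)`
  have e2 : T₂ - M₂ = g₂ * (T₃ - M₃) + X₂ * g₂ * (T₃ - g₃) := by simp only [hT₂, hM₂, hM₃]; noncomm_ring
  have nX₂g : ‖X₂ * g₂‖ ≤ s := (norm_mul_le _ _).trans (by nlinarith [norm_nonneg X₂, norm_nonneg g₂])
  have n2 : ‖T₂ - M₂‖ ≤ 3 * s ^ 2 + s ^ 3 := by
    rw [e2]
    calc ‖g₂ * (T₃ - M₃) + X₂ * g₂ * (T₃ - g₃)‖ ≤ ‖g₂‖ * ‖T₃ - M₃‖ + ‖X₂ * g₂‖ * ‖T₃ - g₃‖ :=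
          (norm_add_le _ _).trans (add_le_add (norm_mul_le _ _) (norm_mul_le _ _))
      _ ≤ 1 * s ^ 2 + s * (2 * s + s ^ 2) := by
          gcongr
      _ = 3 * s ^ 2 + s ^ 3 := by ring
  have e2' : T₂ - g₂ * g₃ = (T₂ - M₂) + (X₂ * g₂ * g₃ + g₂ * (X₃ * g₃) + g₂ * (g₃ * X₄)) := by
    simp only [hM₂]; noncomm_ring
  have n2' : ‖T₂ - g₂ * g₃‖ ≤ 3 * s + 3 * s ^ 2 + s ^ 3 := by
    rw [e2']
    have a1 : ‖X₂ * g₂ * g₃‖ ≤ s := (norm_mul_le _ _).trans (by nlinarith [norm_nonneg (X₂ * g₂), norm_nonneg g₃])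
    have a2 : ‖g₂ * (X₃ * g₃)‖ ≤ s := (norm_mul_le _ _).trans (by nlinarith [norm_nonneg (X₃ * g₃), norm_nonneg g₂])
    have a3 : ‖g₂ * (g₃ * X₄)‖ ≤ s := (norm_mul_le _ _).trans (by nlinarith [norm_nonneg (g₃ * X₄), norm_nonneg g₂])
    calc ‖T₂ - M₂ + (X₂ * g₂ * g₃ + g₂ * (X₃ * g₃) + g₂ * (g₃ * X₄))‖
        ≤ ‖T₂ - M₂‖ + (‖X₂ * g₂ * g₃‖ + ‖g₂ * (X₃ * g₃)‖ + ‖g₂ * (g₃ * X₄)‖) :=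
          (norm_add_le _ _).trans (add_le_add le_rfl ((norm_add_le _ _).trans (add_le_add (norm_add_le _ _) le_rfl)))
      _ ≤ (3 * s ^ 2 + s ^ 3) + (s + s + s) := by gcongr
      _ = 3 * s + 3 * s ^ 2 + s ^ 3 := by ring
  -- level 1
  have e1 : (1 + X₁) * g₁ * (1 + X₂) * g₂ * (1 + X₃) * g₃ * (1 + X₄) - g₁ * g₂ * g₃ -
        (X₁ * g₁ * g₂ * g₃ + g₁ * X₂ * g₂ * g₃ + g₁ * g₂ * X₃ * g₃ + g₁ * g₂ * g₃ * X₄) =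
      g₁ * (T₂ - M₂) + X₁ * g₁ * (T₂ - g₂ * g₃) := by
    rw [sub_sub, hL, hP]; noncomm_ring
  have nX₁g : ‖X₁ * g₁‖ ≤ s := (norm_mul_le _ _).trans (by nlinarith [norm_nonneg X₁, norm_nonneg g₁])
  rw [e1]
  calc ‖g₁ * (T₂ - M₂) + X₁ * g₁ * (T₂ - g₂ * g₃)‖ ≤ ‖g₁‖ * ‖T₂ - M₂‖ + ‖X₁ * g₁‖ * ‖T₂ - g₂ * g₃‖ :=
        (norm_add_le _ _).trans (add_le_add (norm_mul_le _ _) (norm_mul_le _ _))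
    _ ≤ 1 * (3 * s ^ 2 + s ^ 3) + s * (3 * s + 3 * s ^ 2 + s ^ 3) := by gcongr
    _ = 6 * s ^ 2 + 4 * s ^ 3 + s ^ 4 := by ring
    _ ≤ 11 * s ^ 2 := by nlinarith [pow_le_pow_left₀ s0 hs 2, mul_nonneg s0 (sq_nonneg s), sq_nonneg s]

/-- The part linear in the corrections is bounded by the sum of their norms when `‖g_i‖ ≤ 1`. [folklore] -/
private theorem norm_lin4_le {g₁ g₂ g₃ X₁ X₂ X₃ X₄ : 𝔸} (h₁ : ‖g₁‖ ≤ 1) (h₂ : ‖g₂‖ ≤ 1) (h₃ : ‖g₃‖ ≤ 1) :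
    ‖X₁ * g₁ * g₂ * g₃ + g₁ * X₂ * g₂ * g₃ + g₁ * g₂ * X₃ * g₃ + g₁ * g₂ * g₃ * X₄‖ ≤ ‖X₁‖ + ‖X₂‖ + ‖X₃‖ + ‖X₄‖ := by
  have n0 := norm_nonneg X₁; have n2 := norm_nonneg X₂; have n3 := norm_nonneg X₃; have n4 := norm_nonneg X₄
  have g0 := norm_nonneg g₁
  have t1 : ‖X₁ * g₁ * g₂ * g₃‖ ≤ ‖X₁‖ := by
    calc ‖X₁ * g₁ * g₂ * g₃‖ ≤ ‖X₁‖ * ‖g₁‖ * ‖g₂‖ * ‖g₃‖ := by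
          refine (norm_mul_le _ _).trans (mul_le_mul_of_nonneg_right ((norm_mul_le _ _).trans
            (mul_le_mul_of_nonneg_right (norm_mul_le _ _) (norm_nonneg _))) (norm_nonneg _))
      _ ≤ ‖X₁‖ * 1 * 1 * 1 := by gcongr
      _ = ‖X₁‖ := by ring
  have t2 : ‖g₁ * X₂ * g₂ * g₃‖ ≤ ‖X₂‖ := by
    calc ‖g₁ * X₂ * g₂ * g₃‖ ≤ ‖g₁‖ * ‖X₂‖ * ‖g₂‖ * ‖g₃‖ := by
          refine (norm_mul_le _ _).trans (mul_le_mul_of_nonneg_right ((norm_mul_le _ _).trans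
            (mul_le_mul_of_nonneg_right (norm_mul_le _ _) (norm_nonneg _))) (norm_nonneg _))
      _ ≤ 1 * ‖X₂‖ * 1 * 1 := by gcongr
      _ = ‖X₂‖ := by ring
  have t3 : ‖g₁ * g₂ * X₃ * g₃‖ ≤ ‖X₃‖ := by
    calc ‖g₁ * g₂ * X₃ * g₃‖ ≤ ‖g₁‖ * ‖g₂‖ * ‖X₃‖ * ‖g₃‖ := by
          refine (norm_mul_le _ _).trans (mul_le_mul_of_nonneg_right ((norm_mul_le _ _).trans
            (mul_le_mul_of_nonneg_right (norm_mul_le _ _) (norm_nonneg _))) (norm_nonneg _))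
      _ ≤ 1 * 1 * ‖X₃‖ * 1 := by gcongr
      _ = ‖X₃‖ := by ring
  have t4 : ‖g₁ * g₂ * g₃ * X₄‖ ≤ ‖X₄‖ := by
    calc ‖g₁ * g₂ * g₃ * X₄‖ ≤ ‖g₁‖ * ‖g₂‖ * ‖g₃‖ * ‖X₄‖ := by
          refine (norm_mul_le _ _).trans (mul_le_mul_of_nonneg_right ((norm_mul_le _ _).trans
            (mul_le_mul_of_nonneg_right (norm_mul_le _ _) (norm_nonneg _))) (norm_nonneg _))
      _ ≤ 1 * 1 * 1 * ‖X₄‖ := by gcongr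
      _ = ‖X₄‖ := by ring
  calc ‖X₁ * g₁ * g₂ * g₃ + g₁ * X₂ * g₂ * g₃ + g₁ * g₂ * X₃ * g₃ + g₁ * g₂ * g₃ * X₄‖
      ≤ ‖X₁ * g₁ * g₂ * g₃‖ + ‖g₁ * X₂ * g₂ * g₃‖ + ‖g₁ * g₂ * X₃ * g₃‖ + ‖g₁ * g₂ * g₃ * X₄‖ :=
        (norm_add_le _ _).trans (add_le_add ((norm_add_le _ _).trans (add_le_add (norm_add_le _ _) le_rfl)) le_rfl)
    _ ≤ _ := by linarith

/-- **THE PRODUCT OF FOUR CORRECTED TRANSPORTERS AT AVERAGED CORRECTIONS** (the one statement the coarse-plaquette expansion uses):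
if `‖g_i‖ ≤ 1`, `‖X_i‖ ≤ s ≤ 1`, `‖Y_i(k)‖ ≤ t ≤ 1` for all `k` in a nonempty finite index set, and each `X_i` is within `ρ` of the
MEAN `|κ|⁻¹ Σ_k Y_i(k)`, then `(1+X₁)g₁(1+X₂)g₂(1+X₃)g₃(1+X₄)` is within `4ρ + 11s² + 11t²` of the mean over `k` of
`(1+Y₁(k))g₁(1+Y₂(k))g₂(1+Y₃(k))g₃(1+Y₄(k))` — both products are `g₁g₂g₃ +` (a part linear in the corrections) `+ O(2nd order)`,
and the linear parts agree up to `4ρ`. [folklore] -/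
theorem norm_prod4_sub_mean_le [NormedAlgebra ℂ 𝔸] {κ : Type*} [Fintype κ] [Nonempty κ]
    {g₁ g₂ g₃ X₁ X₂ X₃ X₄ : 𝔸} {Y₁ Y₂ Y₃ Y₄ : κ → 𝔸} {s t ρ : ℝ}
    (h₁ : ‖g₁‖ ≤ 1) (h₂ : ‖g₂‖ ≤ 1) (h₃ : ‖g₃‖ ≤ 1)
    (hX₁ : ‖X₁‖ ≤ s) (hX₂ : ‖X₂‖ ≤ s) (hX₃ : ‖X₃‖ ≤ s) (hX₄ : ‖X₄‖ ≤ s) (hs : s ≤ 1)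
    (hY₁ : ∀ k, ‖Y₁ k‖ ≤ t) (hY₂ : ∀ k, ‖Y₂ k‖ ≤ t) (hY₃ : ∀ k, ‖Y₃ k‖ ≤ t) (hY₄ : ∀ k, ‖Y₄ k‖ ≤ t) (ht : t ≤ 1)
    (hρ₁ : ‖X₁ - ((Fintype.card κ : ℂ))⁻¹ • ∑ k, Y₁ k‖ ≤ ρ) (hρ₂ : ‖X₂ - ((Fintype.card κ : ℂ))⁻¹ • ∑ k, Y₂ k‖ ≤ ρ)
    (hρ₃ : ‖X₃ - ((Fintype.card κ : ℂ))⁻¹ • ∑ k, Y₃ k‖ ≤ ρ) (hρ₄ : ‖X₄ - ((Fintype.card κ : ℂ))⁻¹ • ∑ k, Y₄ k‖ ≤ ρ) :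
    ‖(1 + X₁) * g₁ * (1 + X₂) * g₂ * (1 + X₃) * g₃ * (1 + X₄) -
        ((Fintype.card κ : ℂ))⁻¹ • ∑ k, (1 + Y₁ k) * g₁ * (1 + Y₂ k) * g₂ * (1 + Y₃ k) * g₃ * (1 + Y₄ k)‖ ≤
      4 * ρ + 11 * s ^ 2 + 11 * t ^ 2 := by
  have hc : (0 : ℝ) < Fintype.card κ := Nat.cast_pos.mpr Fintype.card_pos
  have hcC : (Fintype.card κ : ℂ) ≠ 0 := by exact_mod_cast hc.ne'
  set c : ℂ := ((Fintype.card κ : ℂ))⁻¹ with hc_def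
  -- abbreviations: the linear parts and the remainders
  set LX : 𝔸 := X₁ * g₁ * g₂ * g₃ + g₁ * X₂ * g₂ * g₃ + g₁ * g₂ * X₃ * g₃ + g₁ * g₂ * g₃ * X₄ with hLX
  set LY : κ → 𝔸 := fun k => Y₁ k * g₁ * g₂ * g₃ + g₁ * Y₂ k * g₂ * g₃ + g₁ * g₂ * Y₃ k * g₃ + g₁ * g₂ * g₃ * Y₄ k
    with hLY
  set RXv : 𝔸 := (1 + X₁) * g₁ * (1 + X₂) * g₂ * (1 + X₃) * g₃ * (1 + X₄) - g₁ * g₂ * g₃ - LX with hRXv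
  set RYv : κ → 𝔸 := fun k => (1 + Y₁ k) * g₁ * (1 + Y₂ k) * g₂ * (1 + Y₃ k) * g₃ * (1 + Y₄ k) - g₁ * g₂ * g₃ - LY k
    with hRYv
  have RX : ‖RXv‖ ≤ 11 * s ^ 2 := norm_prod4_sub_sub_lin4_le h₁ h₂ h₃ hX₁ hX₂ hX₃ hX₄ hs
  have RY : ∀ k, ‖RYv k‖ ≤ 11 * t ^ 2 := fun k => norm_prod4_sub_sub_lin4_le h₁ h₂ h₃ (hY₁ k) (hY₂ k) (hY₃ k) (hY₄ k) ht
  -- the linear parts differ by the linear part of the deviations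
  have hlin : LX - c • ∑ k, LY k =
      (X₁ - c • ∑ k, Y₁ k) * g₁ * g₂ * g₃ + g₁ * (X₂ - c • ∑ k, Y₂ k) * g₂ * g₃ +
        g₁ * g₂ * (X₃ - c • ∑ k, Y₃ k) * g₃ + g₁ * g₂ * g₃ * (X₄ - c • ∑ k, Y₄ k) := by
    simp only [hLX, hLY, Finset.sum_add_distrib, smul_add, Finset.sum_mul, Finset.mul_sum, Finset.smul_sum,
      smul_mul_assoc, mul_smul_comm, sub_mul, mul_sub]
    abel
  have nlin : ‖LX - c • ∑ k, LY k‖ ≤ 4 * ρ := by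
    rw [hlin]
    refine (norm_lin4_le h₁ h₂ h₃).trans ?_
    linarith
  -- the mean of the `Y`-remainders
  have nRY : ‖c • ∑ k, RYv k‖ ≤ 11 * t ^ 2 := norm_mean_le RY (by positivity)
  -- the mean of a constant is the constant
  have hconst : c • ∑ _k : κ, g₁ * g₂ * g₃ = g₁ * g₂ * g₃ := by
    rw [Finset.sum_const, Finset.card_univ, ← Nat.cast_smul_eq_nsmul ℂ, smul_smul, hc_def, inv_mul_cancel₀ hcC, one_smul]
  -- assemble
  have key : (1 + X₁) * g₁ * (1 + X₂) * g₂ * (1 + X₃) * g₃ * (1 + X₄) -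
      c • ∑ k, (1 + Y₁ k) * g₁ * (1 + Y₂ k) * g₂ * (1 + Y₃ k) * g₃ * (1 + Y₄ k) =
      RXv + (LX - c • ∑ k, LY k) - c • ∑ k, RYv k := by
    have hY : ∀ k, (1 + Y₁ k) * g₁ * (1 + Y₂ k) * g₂ * (1 + Y₃ k) * g₃ * (1 + Y₄ k) = RYv k + g₁ * g₂ * g₃ + LY k := by
      intro k; simp only [hRYv]; abel
    have hX : (1 + X₁) * g₁ * (1 + X₂) * g₂ * (1 + X₃) * g₃ * (1 + X₄) = RXv + g₁ * g₂ * g₃ + LX := by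
      simp only [hRXv]; abel
    rw [Finset.sum_congr rfl fun k _ => hY k, hX, Finset.sum_add_distrib, Finset.sum_add_distrib, smul_add, smul_add,
      hconst]
    abel
  rw [key]
  calc ‖RXv + (LX - c • ∑ k, LY k) - c • ∑ k, RYv k‖ ≤ ‖RXv‖ + ‖LX - c • ∑ k, LY k‖ + ‖c • ∑ k, RYv k‖ :=
        norm_sub_le_of_le (norm_add_le _ _) le_rfl
    _ ≤ 11 * s ^ 2 + 4 * ρ + 11 * t ^ 2 := add_le_add (add_le_add RX nlin) nRY
    _ = 4 * ρ + 11 * s ^ 2 + 11 * t ^ 2 := by ring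

end Prod4

end Summit.QuantumFields.YangMills.Theorems.AvgActionDefect

end
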